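import Summits.CriticalPhenomena.PercolationContinuityZ3.Theses.PercShatteringRace
import Literature.Probability.Percolation.SharpnessDCTProofs
import Literature.Probability.Percolation.CriticalContinuityProofs

/-!
# Disproof attempts on `FreeSusceptibilityPowerSaving` (crux S(1/2), item stmt-CriticalPhenomena-5786)

Work file of the standing crux disprover (refuter-cdisprove-stmt-CriticalPhenomena-5786).
The crux reads (route `PercShatteringRace`):

  `S(1/2)`: `∃ C, ∀ R ≥ 1, χᶠ_R(p_c) := Σ_{y ∈ Λ_R} P_{p_c}(0 ↔ y inside Λ_R) ≤ C · R^{5/2}`,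

`Λ_R = box 3 R = [-R, R]³`, bond percolation on `ℤ³` at `p_c = criticalProbI 3`, free boundary
condition (`openConnIn`).  Everything below is sorry-free unless marked NEAR-MISS.

## Findings (index)

* `crux_iff` — the crux is `PowerBound 3 p_c (5/2)` for the parametrised family
  `PowerBound d p e : ∃ C, ∀ R ≥ 1, freeSusc d p R ≤ C R^e` studied here.
* (a) LOAD-BEARING HYPOTHESES
  - `crux_false_without_one_le` : dropping `1 ≤ R` makes S false (`R = 0`: `χᶠ_0 = 1 > C · 0^{5/2}`).
  - `crux_false_at_p_one` : the same bound at `p = 1` instead of `p = p_c` is false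
    (`χᶠ_R(1) = (2R+1)³`); more generally `not_powerBound_one : e < d → ¬ PowerBound d 1 e`.
    Any proof must use an input that fails at `p = 1` (i.e. genuinely critical/subcritical information).
  - `powerBound_anti_p` : `PowerBound` is monotone in `p`, so S at `p_c` is EQUIVALENT to S uniformly
    on `[0, p_c]`; and `powerBound_zero_of_lt_criticalProb` : for every `p < p_c` even the exponent
    `0` holds (sharpness, Duminil-Copin–Tassion): the crux lives exactly AT `p_c`.
  - `dim_two_analogue_trivial` : in `d = 2` the same exponent `5/2` is free (volume `9R²`): the
    dimension `3 > 5/2` is what makes S a saving.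
* (b) TIGHTNESS / RIGOROUS WINDOW for the exponent `e` in `PowerBound 3 p_c e`:
  - `powerBound_self : PowerBound d p d` (volume bound, every `p`): `e = 3` is free;
  - `not_powerBound_crit_of_lt_one : e < 1 → ¬ PowerBound d p_c e` (`d ≥ 2`), from the
    Duminil-Copin–Tassion input `φ_{p_c}(Λ_n) ≥ 1` (`one_le_phi_crit`, proved here from the tree's
    `p̃_c = p_c`) which gives the FLOOR `χᶠ_R(p_c) ≥ R/(2d)` (`freeSusc_crit_ge`).
    So rigorously `e ∈ [1, 3]`; the crux asks `e = 5/2`; numerics `e = 2 - η ≈ 2.05`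
    (η(3) = -0.046); mean-field/Gaussian value `2`.  No rigorous tool separates `5/2` from `3` in `d = 3`.
* (c) NATURAL STRENGTHENINGS refuted / reduced
  - exponent below `1`: false (above);  exponent `< 0`: false at every `p` (`not_powerBound_of_neg`).
  - `not_powerBound_of_boxLRO` : linear-scale in-box long-range order at `p_c` (`BoxLRO`, the
    MONOLITHIC jump branch) contradicts `PowerBound 3 p_c e` for every `e < 3`; equivalently S(a) for
    ANY `a > 0` already excludes that branch (`not_boxLRO_of_crux`); and `BoxLRO` IS a jump world:
    `theta_pos_of_boxLRO` / `not_percolationContinuityZ3_of_boxLRO` (`BoxLRO → θ(p_c) > 0 → ¬ summit`).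
    This is why S has no soft proof: a proof of S refutes monolithic discontinuity at `p_c`, an open
    sub-case of the negation of the summit.
  - NUMERICALLY DEAD SPLIT (no Lean content, exponent bookkeeping): the route's foreseen two-layer plan
    `S ⇐ S₁ ∧ S₂` with `S₁ = LargestFreeClusterBound: E|K_max(Λ_R)| (or typical M_R) ≤ C R^{5/2}` and
    `S₂`: `E|C_Λ(0)| ≤ E|K_max|` (Hutchcroft arXiv:2008.11197 Thm 2.2) cannot reach `a = 1/2`:
    at `p_c(ℤ³)` the largest critical cluster of a box of side `R` has `|K_max| ≍ R^{d_f}`,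
    `d_f = d - β/ν = 2.523 > 5/2`, so `S₁(5/2)` is predicted FALSE (margin 0.023) although
    `E|C_Λ(0)| ≍ R^{2-η} = R^{2.05}` (the origin lies in `K_max` only with probability `≍ R^{-β/ν}`).
    Via `K_max` one gets at best `S(a)` for `a < β/ν = 0.477`; the race still closes there:
    `(a, b) = (0.45, 1/6)` gives `(7/6)(2.55) = 2.975 < 3` (RaceLemma covers it) — recommend the planner
    re-instantiate at `a = 0.45` if the `K_max` split is pursued, or keep `a = 1/2` and avoid `K_max`.
  - `freeSusc_le_bulk` : S is weaker than the bulk ball bound (PercTwoPointDecay's crux at a = 1/2);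
    `powerBound_of_dyadic` / `crux_of_dyadic` : it suffices to prove S along `R = 2^k` (monotonicity in `R`).
* (d) TARGETS (lead's stuck stubs): none filed yet (payload.stuck_stubs = []).
* (e) NUMERICS (MC, bond `p_c = 0.2488126`, crux-ideate job j005901, summary
  `Cruxes/FreeSusceptibilityPowerSaving/MC-summary-ideator1-j005901.md`; my own job j004795/j005054 was
  cancelled unrun after 6 h in a saturated queue): log-log slope of the centre-rooted `E|C_Λ(0)| = χᶠ_R`
  is `1.96` (`R ≤ 64`; prediction `2 − η = 2.046`) — S(1/2) numerically TRUE with margin `≈ 0.5`;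
  root-averaged susceptibility slope `1.97–2.02`; `|K_max|` slope `2.49–2.52` (`d_f = 2.523`) — confirming
  that the `K_max` split at `a = 1/2` is dead (item (c)).
* (f) TREE CROSS-REFERENCES (sibling disprovers landed overlapping infrastructure while this file was
  written; the landable residue for THIS crux is filed as
  `Theorems/FreeSusceptibilityPowerSaving/Negative/FreeSusceptibilityPowerSavingBounds.lean`):
  `one_le_phi_crit` = `Literature.Barriers.CriticalPhenomena.one_le_phi_criticalProbI`
  (KozmaNachmiasLemma31.lean); `freeSusc_crit_ge` ⊂ `Theorems/FreeBoxSparse/Negative/DCTFloor.lean`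
  `sum_box_real_openConnIn_ge` (all `p ≥ p_c`, constant `(n+1)/6`); `freeSusc_one` ⊂
  `FreeBoxPowerSaving/Negative/FreeBoxPowerSavingBounds.lean` `real_openConnIn_one`;
  `openConnIn_mono_set` = `Literature.Probability.Percolation.openConnIn_mono` (RSW.lean);
  S(1/2) ⟹ `FreeBoxPowerSaving` (4447) via `freeBoxPowerSaving_iff_centredPowerSaving`
  (FreeBoxPowerSavingProfile.lean).

WHY IT RESISTS.  Refuting S needs `χᶠ_R(p_c) ≥ R^{5/2+κ}` along a sequence, i.e. either a critical
two-point function far above every prediction (`2 - η = 2.05 < 2.5`) or linear-scale in-box order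
at `p_c` (monolithic jump).  The only unconditional lower-bound technology (DCT `φ ≥ 1`,
Hammersley/Simon–Lieb) stops at order `R` (`freeSusc_crit_ge`); the only unconditional upper bound is
the volume `(2R+1)³` — even the qualitative `o(R³)` is unlocated 'folklore' (Hutchcroft 2022 p.5; see
`BoxLRO`).  Conversely PROVING S must beat `p = 1` (`crux_false_at_p_one`) and refute `BoxLRO`
(`not_boxLRO_of_crux`), for which no same-`p`, `d = 3` tool is known.
-/

namespace Summit.CriticalPhenomena.PercolationContinuityZ3.Cruxes.FreeSusceptibilityPowerSaving.Disproof

open MeasureTheory Filter Topology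
open Literature.Probability.Percolation Literature.Probability.LatticeModels
open Literature.Probability.Percolation.DCT16
open Summit.CriticalPhenomena.PercolationContinuityZ3.Theses.PercShatteringRace
open scoped ProbabilityTheory

noncomputable section

variable {d : ℕ}

/-! ### The parametrised family -/

/-- The free (in-box) susceptibility of the centre of `Λ_R ⊆ ℤ^d` at parameter `p`:
`χᶠ_R(p) = Σ_{y ∈ Λ_R} P_p(0 ↔ y inside Λ_R) = E_p |C_{Λ_R}(0)|`. -/
def freeSusc (d : ℕ) (p : unitInterval) (R : ℕ) : ℝ :=
  ∑ y ∈ box d R, (bondPercolation (zdGraph d) p).real (openConnIn (↑(box d R) : Set (Site d)) 0 y)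

/-- `S_p(e)`: the power bound `χᶠ_R(p) ≤ C R^e` for `R ≥ 1`.  The crux is `PowerBound 3 p_c (5/2)`. -/
def PowerBound (d : ℕ) (p : unitInterval) (e : ℝ) : Prop :=
  ∃ C : ℝ, ∀ R : ℕ, 1 ≤ R → freeSusc d p R ≤ C * (R : ℝ) ^ e

/-- The crux, literally, is `PowerBound 3 p_c (5/2)`. -/
theorem crux_iff : FreeSusceptibilityPowerSaving ↔ PowerBound 3 (criticalProbI 3) ((5 : ℝ) / 2) :=
  Iff.rfl

/-! ### Elementary bounds: `1 ≤ χᶠ_R ≤ (2R+1)^d`, `χᶠ_0 = 1` -/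

theorem freeSusc_nonneg (d : ℕ) (p : unitInterval) (R : ℕ) : 0 ≤ freeSusc d p R :=
  Finset.sum_nonneg fun _ _ => measureReal_nonneg

/-- The `y = 0` term is `P_p(0 ↔ 0 in Λ_R) = 1`. -/
theorem real_openConnIn_self (p : unitInterval) (R : ℕ) :
    (bondPercolation (zdGraph d) p).real (openConnIn (↑(box d R) : Set (Site d)) 0 0) = 1 := by
  have h0 : (0 : Site d) ∈ (↑(box d R) : Set (Site d)) := Finset.mem_coe.2 (zero_mem_box d R)
  have : openConnIn (↑(box d R) : Set (Site d)) (0 : Site d) 0 = Set.univ :=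
    Set.eq_univ_of_forall fun ω => ⟨h0, h0, SimpleGraph.Reachable.refl _⟩
  rw [this, probReal_univ]

theorem one_le_freeSusc (d : ℕ) (p : unitInterval) (R : ℕ) : 1 ≤ freeSusc d p R := by
  unfold freeSusc
  rw [← real_openConnIn_self (d := d) p R]
  exact Finset.single_le_sum (f := fun y => (bondPercolation (zdGraph d) p).real
    (openConnIn (↑(box d R) : Set (Site d)) 0 y)) (fun _ _ => measureReal_nonneg) (zero_mem_box d R)

theorem freeSusc_le_card (d : ℕ) (p : unitInterval) (R : ℕ) :
    freeSusc d p R ≤ ((2 * R + 1) ^ d : ℕ) := by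
  unfold freeSusc
  calc ∑ y ∈ box d R, (bondPercolation (zdGraph d) p).real (openConnIn (↑(box d R) : Set (Site d)) 0 y)
      ≤ ∑ _y ∈ box d R, (1 : ℝ) := Finset.sum_le_sum fun _ _ => measureReal_le_one
    _ = ((2 * R + 1) ^ d : ℕ) := by rw [Finset.sum_const, card_box]; simp

theorem box_zero (d : ℕ) : box d 0 = {0} := by
  ext x
  simp only [mem_box, Nat.cast_zero, neg_zero, Finset.mem_singleton]
  constructor
  · intro h; funext i; have := h i; simp only [Pi.zero_apply]; omega
  · rintro rfl i; simp

/-- `χᶠ_0(p) = 1` at every `p`. -/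
theorem freeSusc_zero (d : ℕ) (p : unitInterval) : freeSusc d p 0 = 1 := by
  unfold freeSusc
  rw [box_zero, Finset.sum_singleton]
  have := real_openConnIn_self (d := d) p 0
  rwa [box_zero] at this

/-! ### (a) Load-bearing: the side condition `1 ≤ R` -/

/-- The crux with the restriction `1 ≤ R` dropped. -/
def CruxWithoutOneLe : Prop :=
  ∃ C : ℝ, ∀ R : ℕ, freeSusc 3 (criticalProbI 3) R ≤ C * (R : ℝ) ^ ((5 : ℝ) / 2)

/-- Dropping `1 ≤ R` falsifies S: at `R = 0`, `χᶠ_0 = 1` while `C · 0^{5/2} = 0`.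
(So `1 ≤ R` is not decoration; any `R ≥ 1` version with `C` enlarged is equivalent to S.) -/
theorem crux_false_without_one_le : ¬ CruxWithoutOneLe := by
  rintro ⟨C, hC⟩
  have h := hC 0
  rw [freeSusc_zero, Nat.cast_zero, Real.zero_rpow (by norm_num), mul_zero] at h
  exact absurd h (by norm_num)

/-! ### A growth lemma: a lower bound `a R^s` kills every `PowerBound` with exponent `e < s` -/

/-- If eventually `f R ≥ a R^s` with `a > 0`, then `f R ≤ C R^e` for all `R ≥ 1` is impossible for
`e < s`. -/
theorem not_bound_of_lower {f : ℕ → ℝ} {a s : ℝ} (ha : 0 < a) {N : ℕ}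
    (hlow : ∀ R : ℕ, N ≤ R → a * (R : ℝ) ^ s ≤ f R) {e : ℝ} (he : e < s) :
    ¬ ∃ C : ℝ, ∀ R : ℕ, 1 ≤ R → f R ≤ C * (R : ℝ) ^ e := by
  rintro ⟨C, hC⟩
  have hse : 0 < s - e := sub_pos.2 he
  have ht : Tendsto (fun R : ℕ => a * ((R : ℝ) ^ (s - e))) atTop atTop :=
    Tendsto.const_mul_atTop ha ((tendsto_rpow_atTop hse).comp tendsto_natCast_atTop_atTop)
  obtain ⟨R, hgt, hR1, hRN⟩ :=
    ((ht.eventually_gt_atTop C).and ((eventually_ge_atTop 1).and (eventually_ge_atTop N))).exists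
  have hRpos : (0 : ℝ) < R := by exact_mod_cast hR1
  have h1 := (hlow R hRN).trans (hC R hR1)
  have hsplit : (R : ℝ) ^ s = (R : ℝ) ^ (s - e) * (R : ℝ) ^ e := by
    rw [← Real.rpow_add hRpos]; ring_nf
  rw [hsplit, ← mul_assoc] at h1
  have h2 := le_of_mul_le_mul_right h1 (Real.rpow_pos_of_pos hRpos e)
  linarith

/-- Exponents `e < 0` are impossible at every `p` (`χᶠ_R ≥ 1`). -/
theorem not_powerBound_of_neg (d : ℕ) (p : unitInterval) {e : ℝ} (he : e < 0) :
    ¬ PowerBound d p e :=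
  not_bound_of_lower (f := freeSusc d p) (a := 1) (s := 0) one_pos (N := 0)
    (fun R _ => by rw [Real.rpow_zero, mul_one]; exact one_le_freeSusc d p R) he

/-- The volume bound: `PowerBound d p d` holds at every `p` (`χᶠ_R ≤ (2R+1)^d ≤ 3^d R^d`).
In `d = 3`: S(0) is free, the content of the crux is the saving `a = 1/2`. -/
theorem powerBound_self (d : ℕ) (p : unitInterval) : PowerBound d p d := by
  refine ⟨(3 : ℝ) ^ d, fun R hR => (freeSusc_le_card d p R).trans ?_⟩
  have hR' : (1 : ℝ) ≤ R := by exact_mod_cast hR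
  rw [Real.rpow_natCast]
  calc (((2 * R + 1) ^ d : ℕ) : ℝ) = ((2 * R + 1 : ℕ) : ℝ) ^ d := by push_cast; ring
    _ ≤ ((3 : ℝ) * R) ^ d := by
        apply pow_le_pow_left₀ (by positivity)
        push_cast; linarith
    _ = (3 : ℝ) ^ d * (R : ℝ) ^ d := by rw [mul_pow]

/-- Monotonicity in the exponent. -/
theorem PowerBound.mono {p : unitInterval} {e e' : ℝ} (h : PowerBound d p e) (hee' : e ≤ e') :
    PowerBound d p e' := by
  obtain ⟨C, hC⟩ := h
  refine ⟨max C 0, fun R hR => (hC R hR).trans ?_⟩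
  have hR' : (1 : ℝ) ≤ R := by exact_mod_cast hR
  calc C * (R : ℝ) ^ e ≤ max C 0 * (R : ℝ) ^ e :=
        mul_le_mul_of_nonneg_right (le_max_left _ _) (Real.rpow_nonneg (by linarith) _)
    _ ≤ max C 0 * (R : ℝ) ^ e' :=
        mul_le_mul_of_nonneg_left (Real.rpow_le_rpow_of_exponent_le hR' hee') (le_max_right _ _)

/-- **Dimension is load-bearing**: the `d = 2` analogue of the crux (same exponent `5/2`) is trivially
true at EVERY `p` by the volume bound `(2R+1)² ≤ 9 R^{5/2}`; `d = 3` is the first dimension in which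
`5/2 < d` makes S a genuine power SAVING. -/
theorem dim_two_analogue_trivial (p : unitInterval) : PowerBound 2 p ((5 : ℝ) / 2) :=
  (powerBound_self 2 p).mono (by norm_num)

/-! ### (a) Load-bearing: criticality — the bound is false at `p = 1` -/

/-- Inside a box every site is joined to the centre by a lattice path staying in the box
(decrease one coordinate of absolute value at a time). -/
theorem pathIn_box (R : ℕ) {G : SimpleGraph (Site d)} (hG : zdGraph d ≤ G) :
    ∀ y ∈ box d R, PathIn G (↑(box d R) : Set (Site d)) 0 y := by
  suffices h : ∀ n : ℕ, ∀ y ∈ box d R, (∑ j, |y j|) < n → PathIn G (↑(box d R) : Set (Site d)) 0 y from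
    fun y hy => h ((∑ j, |y j|).toNat + 1) y hy
      (by push_cast; have := Int.self_le_toNat (∑ j, |y j|); omega)
  intro n
  induction n with
  | zero =>
    intro y _ hlt
    have : (0 : ℤ) ≤ ∑ j, |y j| := Finset.sum_nonneg fun j _ => abs_nonneg _
    omega
  | succ n ih =>
    intro y hy hlt
    by_cases h0 : y = 0
    · subst h0; exact PathIn.refl (Finset.mem_coe.2 (zero_mem_box d R))
    obtain ⟨i, hi⟩ : ∃ i, y i ≠ 0 := by
      by_contra h
      push Not at h
      exact h0 (funext h)
    -- step towards the origin in coordinate `i`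
    set s : ℤ := if 0 < y i then 1 else -1 with hs
    set y' : Site d := Function.update y i (y i - s) with hy'
    have hyi : |y i - s| = |y i| - 1 := by
      rw [hs]; split_ifs with hpos
      · rw [abs_of_nonneg (by omega), abs_of_pos hpos]
      · push Not at hpos
        have hneg : y i < 0 := lt_of_le_of_ne hpos hi
        rw [abs_of_nonpos (by omega), abs_of_neg hneg]; ring
    have hmem : y' ∈ box d R := by
      rw [mem_box] at hy ⊢
      intro j
      rw [hy']
      rcases eq_or_ne j i with rfl | hji
      · rw [Function.update_self]
        have h1 := hy j
        have h2 : |y j - s| ≤ R := by rw [hyi]; have := abs_le.2 ⟨by linarith [h1.1], h1.2⟩; linarith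
        exact abs_le.1 h2
      · rw [Function.update_of_ne hji]; exact hy j
    have hsum : (∑ j, |y' j|) = (∑ j, |y j|) - 1 := by
      have e1 : (fun j => |y' j|) = Function.update (fun j => |y j|) i |y i - s| := by
        funext j
        rw [hy']
        rcases eq_or_ne j i with rfl | hji
        · simp
        · simp [Function.update_of_ne hji]
      rw [show (∑ j, |y' j|) = ∑ j, (fun j => |y' j|) j from rfl, e1,
        Finset.sum_update_of_mem (Finset.mem_univ i), hyi,
        Finset.sum_eq_add_sum_sdiff_singleton_of_mem (Finset.mem_univ i) (fun j => |y j|)]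
      ring
    have hlt' : (∑ j, |y' j|) < n := by rw [hsum]; omega
    have hadj : G.Adj y' y := by
      apply hG
      rw [zdGraph_adj_iff]
      refine ⟨i, ?_⟩
      rw [hs] at hy'
      split_ifs at hy' with hpos
      · left; funext j
        rw [hy']
        rcases eq_or_ne j i with rfl | hji
        · simp
        · simp [Function.update_of_ne hji, Pi.single_eq_of_ne hji]
      · right; funext j
        rw [hy']
        rcases eq_or_ne j i with rfl | hji
        · simp
        · simp [Function.update_of_ne hji, Pi.single_eq_of_ne hji]
    exact (ih y' hmem hlt').tail hadj (Finset.mem_coe.2 hy)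

/-- At `p = 1` every lattice edge is open and `χᶠ_R(1) = |Λ_R| = (2R+1)^d`. -/
theorem freeSusc_one (d R : ℕ) : freeSusc d 1 R = ((2 * R + 1) ^ d : ℕ) := by
  unfold freeSusc
  have hmeas : bondPercolation (zdGraph d) 1 = Measure.dirac (zdGraph d).edgeSet := by
    rw [bondPercolation]; exact ProbabilityTheory.setBernoulli_one _
  have hG : zdGraph d ≤ openGraph ((zdGraph d).edgeSet) := fun x y h =>
    (openGraph_adj _ _ _).2 ⟨(SimpleGraph.mem_edgeSet _).2 h, h.ne⟩
  have hterm : ∀ y ∈ box d R,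
      (bondPercolation (zdGraph d) 1).real (openConnIn (↑(box d R) : Set (Site d)) 0 y) = 1 := by
    intro y hy
    rw [hmeas, measureReal_def, Measure.dirac_apply_of_mem, ENNReal.toReal_one]
    exact mem_openConnIn_of_pathIn (pathIn_box R hG y hy)
  rw [Finset.sum_congr rfl hterm, Finset.sum_const, card_box]
  simp

/-- **The power bound is false at `p = 1` for every exponent `e < d`** (in particular the crux's
`5/2 < 3`): `χᶠ_R(1) = (2R+1)^d ≥ R^d`. -/
theorem not_powerBound_one {e : ℝ} (he : e < d) : ¬ PowerBound d 1 e := by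
  refine not_bound_of_lower (f := freeSusc d 1) (a := 1) (s := d) one_pos (N := 0) (fun R _ => ?_) he
  rw [freeSusc_one, one_mul, Real.rpow_natCast]
  have : ((R : ℕ) : ℝ) ^ d ≤ (((2 * R + 1 : ℕ)) : ℝ) ^ d := by
    apply pow_le_pow_left₀ (by positivity); exact_mod_cast (by omega : R ≤ 2 * R + 1)
  exact_mod_cast this

/-- The crux's bound transplanted to `p = 1` is false: a proof of S must use an input that is false
at `p = 1` (criticality enters only through the value of the parameter). -/
theorem crux_false_at_p_one : ¬ PowerBound 3 1 ((5 : ℝ) / 2) :=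
  not_powerBound_one (d := 3) (by norm_num)

/-! ### Monotonicity: in the set (free ≤ bulk) and in the parameter `p` -/

/-- `{0 ↔ y in S} ⊆ {0 ↔ y in T}` for `S ⊆ T`. -/
theorem openConnIn_mono_set {V : Type*} {S T : Set V} (hST : S ⊆ T) (x y : V) :
    (openConnIn S x y : Set (BondConfig V)) ⊆ openConnIn T x y := fun _ h =>
  mem_openConnIn_of_pathIn ((pathIn_of_mem_openConnIn h).mono hST)

/-- Free ≤ bulk: `{x ↔ y in S} ⊆ {x ↔ y}`; so the bulk two-point bound of
`PercTwoPointDecay.CritBallAverageDecay` (a = 1/2) implies S, never conversely. -/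
theorem openConnIn_subset_openConn {V : Type*} (S : Set V) (x y : V) :
    (openConnIn S x y : Set (BondConfig V)) ⊆ openConn x y := by
  rintro ω ⟨hx, hy, hr⟩
  exact hr.map (SimpleGraph.Embedding.induce S).toHom

/-- `p ↦ χᶠ_R(p)` is non-decreasing (increasing events, monotone coupling). -/
theorem freeSusc_mono (d R : ℕ) : Monotone fun p => freeSusc d p R := fun _ _ hpq =>
  Finset.sum_le_sum fun y _ => real_mono_of_isUpperSet (zdGraph d) (isUpperSet_openConnIn _ _ _)
    (measurableSet_openConnIn _ 0 y) hpq

/-- `PowerBound` is inherited downwards in `p`. -/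
theorem PowerBound.anti {p q : unitInterval} (hpq : p ≤ q) {e : ℝ} (h : PowerBound d q e) :
    PowerBound d p e := by
  obtain ⟨C, hC⟩ := h
  exact ⟨C, fun R hR => (freeSusc_mono d R hpq).trans (hC R hR)⟩

/-- S at `p_c` is equivalent to S UNIFORMLY on `[0, p_c]` (same constant): strengthening the crux to
all `p ≤ p_c` is not a strengthening. -/
theorem crux_iff_uniform :
    FreeSusceptibilityPowerSaving ↔ ∃ C : ℝ, ∀ p : unitInterval, p ≤ criticalProbI 3 →
      ∀ R : ℕ, 1 ≤ R → freeSusc 3 p R ≤ C * (R : ℝ) ^ ((5 : ℝ) / 2) := by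
  rw [crux_iff]
  constructor
  · rintro ⟨C, hC⟩
    exact ⟨C, fun p hp R hR => (freeSusc_mono 3 R hp).trans (hC R hR)⟩
  · rintro ⟨C, hC⟩
    exact ⟨C, fun R hR => hC _ le_rfl R hR⟩

/-- Free ≤ bulk, summed: `χᶠ_R(p) ≤ Σ_{y ∈ Λ_R} τ_p(0, y)` (bulk ball sum); hence the bulk bound of
route PercTwoPointDecay (`CritBallAverageDecay` at `a = 1/2`) implies S — S is the WEAKER statement. -/
theorem freeSusc_le_bulk (d : ℕ) (p : unitInterval) (R : ℕ) :
    freeSusc d p R ≤ ∑ y ∈ box d R, (bondPercolation (zdGraph d) p).real (openConn 0 y) :=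
  Finset.sum_le_sum fun y _ => measureReal_mono (openConnIn_subset_openConn _ 0 y)

/-- `R ↦ χᶠ_R(p)` is non-decreasing (bigger box: more terms, larger events). -/
theorem freeSusc_mono_right (d : ℕ) (p : unitInterval) : Monotone (freeSusc d p) := by
  intro R R' hRR'
  unfold freeSusc
  calc ∑ y ∈ box d R, (bondPercolation (zdGraph d) p).real (openConnIn (↑(box d R) : Set (Site d)) 0 y)
      ≤ ∑ y ∈ box d R, (bondPercolation (zdGraph d) p).real
          (openConnIn (↑(box d R') : Set (Site d)) 0 y) :=
        Finset.sum_le_sum fun y _ => measureReal_mono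
          (openConnIn_mono_set (Finset.coe_subset.2 (box_mono d hRR')) 0 y)
    _ ≤ ∑ y ∈ box d R', (bondPercolation (zdGraph d) p).real
          (openConnIn (↑(box d R') : Set (Site d)) 0 y) :=
        Finset.sum_le_sum_of_subset_of_nonneg (box_mono d hRR') fun _ _ _ => measureReal_nonneg

/-- **Dyadic reduction** (information for provers): by monotonicity in `R` it suffices to bound
`χᶠ_{2^k}(p) ≤ C · 2^{k e}` along the dyadic scales (`e ≥ 0`). -/
theorem powerBound_of_dyadic {p : unitInterval} {e : ℝ} (he : 0 ≤ e) {C : ℝ}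
    (h : ∀ k : ℕ, freeSusc d p (2 ^ k) ≤ C * (2 : ℝ) ^ ((k : ℝ) * e)) : PowerBound d p e := by
  refine ⟨max C 0 * (2 : ℝ) ^ e, fun R hR => ?_⟩
  set k := Nat.log 2 R + 1 with hk
  have hRlt : R < 2 ^ k := Nat.lt_pow_succ_log_self (by norm_num) R
  have hle : 2 ^ (k - 1) ≤ R := by
    rw [hk, Nat.add_sub_cancel]; exact Nat.pow_log_le_self 2 (by omega)
  have h2 : (2 : ℝ) ^ ((k : ℝ) - 1) = ((2 ^ (k - 1) : ℕ) : ℝ) := by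
    rw [Nat.cast_pow, Nat.cast_ofNat, ← Real.rpow_natCast, Nat.cast_sub (by omega : 1 ≤ k),
      Nat.cast_one]
  have hkR : (2 : ℝ) ^ ((k : ℝ) - 1) ≤ R := by rw [h2]; exact_mod_cast hle
  have hexp : (2 : ℝ) ^ ((k : ℝ) * e) = (2 : ℝ) ^ e * ((2 : ℝ) ^ ((k : ℝ) - 1)) ^ e := by
    rw [← Real.rpow_mul (by norm_num : (0 : ℝ) ≤ 2), ← Real.rpow_add (by norm_num : (0 : ℝ) < 2)]
    congr 1; ring
  calc freeSusc d p R ≤ freeSusc d p (2 ^ k) := freeSusc_mono_right d p hRlt.le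
    _ ≤ C * (2 : ℝ) ^ ((k : ℝ) * e) := h k
    _ ≤ max C 0 * (2 : ℝ) ^ ((k : ℝ) * e) :=
        mul_le_mul_of_nonneg_right (le_max_left _ _) (by positivity)
    _ = max C 0 * (2 : ℝ) ^ e * ((2 : ℝ) ^ ((k : ℝ) - 1)) ^ e := by rw [hexp, mul_assoc]
    _ ≤ max C 0 * (2 : ℝ) ^ e * (R : ℝ) ^ e := by
        apply mul_le_mul_of_nonneg_left _ (by positivity)
        exact Real.rpow_le_rpow (by positivity) hkR he

/-- The crux from its dyadic instances: `χᶠ_{2^k}(p_c) ≤ C · 2^{5k/2}` for all `k` suffices. -/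
theorem crux_of_dyadic {C : ℝ}
    (h : ∀ k : ℕ, freeSusc 3 (criticalProbI 3) (2 ^ k) ≤ C * (2 : ℝ) ^ ((k : ℝ) * ((5 : ℝ) / 2))) :
    FreeSusceptibilityPowerSaving :=
  crux_iff.2 (powerBound_of_dyadic (by norm_num) h)

/-! ### (b) The rigorous floor at `p_c`: `φ_{p_c}(S) ≥ 1` and `χᶠ_R(p_c) ≥ R/(2d)` -/

/-- `q ↦ P_q(0 ↔ x in S)` is a polynomial in `q` (cylinder expansion), hence continuous. -/
theorem continuous_cylPoly_openConnIn (S : Finset (Site d)) (x : Site d) :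
    Continuous (Russo.cylPoly (zdGraph d).edgeSet S.sym2 (openConnIn (↑S : Set (Site d)) 0 x)) := by
  classical
  exact continuous_iff_continuousAt.2 fun q => (Russo.hasDerivAt_cylPoly _ _ _ q).continuousAt

/-- `φ_q(S)` as the polynomial `q · Σ_x Σ_{y ∼ x, y ∉ S} cylPoly(…)(q)`. -/
theorem phi_eq_poly (S : Finset (Site d)) (q : unitInterval) :
    DCT16.phi q S = (q : ℝ) * ∑ x ∈ S, ∑ y ∈ (zdGraph d).neighborFinset x with y ∉ S,
      Russo.cylPoly (zdGraph d).edgeSet S.sym2 (openConnIn (↑S : Set (Site d)) 0 x) q := by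
  rw [DCT16.phi_def]
  congr 1
  refine Finset.sum_congr rfl fun x _ => Finset.sum_congr rfl fun y _ => ?_
  rw [bondPercolation]
  exact Russo.measureReal_eq_cylPoly
    (determinedBy_openConnIn (↑S : Set (Site d)) 0 x (K := (↑S.sym2 : Set (Sym2 (Site d))))
      (by rw [Finset.coe_sym2])) _ _

/-- **`φ_{p_c}(S) ≥ 1` for every finite `S ∋ 0`, `d ≥ 2`** (Duminil-Copin–Tassion 2016, Thm 1.1 with
Remark 3): if `φ_{p_c}(S) < 1` then, `φ_·(S)` being a polynomial, `φ_q(S) < 1` for some `q ∈ (p_c, 1]`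
(`p_c < 1`, Grimmett Thm (1.10)), whence `q ≤ p̃_c = p_c` (tree: `tildeCriticalProb_le_criticalProb`),
absurd. -/
theorem one_le_phi_crit (hd : 2 ≤ d) (S : Finset (Site d)) (h0 : (0 : Site d) ∈ S) :
    1 ≤ DCT16.phi (criticalProbI d) S := by
  by_contra hlt
  push Not at hlt
  set pc : ℝ := criticalProb (zdGraph d) 0 with hpc
  have hpc1 : pc < 1 := criticalProb_zd_lt_one hd
  have hpc0 : 0 ≤ pc := (criticalProb_mem_Icc (zdGraph d) (0 : Site d)).1
  set g : ℝ → ℝ := fun q => q * ∑ x ∈ S, ∑ y ∈ (zdGraph d).neighborFinset x with y ∉ S,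
      Russo.cylPoly (zdGraph d).edgeSet S.sym2 (openConnIn (↑S : Set (Site d)) 0 x) q with hg
  have hφg : ∀ q : unitInterval, DCT16.phi q S = g q := fun q => phi_eq_poly S q
  have hcont : Continuous g :=
    continuous_id.mul (continuous_finsetSum _ fun x _ => continuous_finsetSum _ fun _ _ =>
      continuous_cylPoly_openConnIn S x)
  have hgc : g pc < 1 := by
    have := hφg (criticalProbI d)
    rw [coe_criticalProbI] at this
    rw [← this]; exact hlt
  obtain ⟨ε, hε, hball⟩ :=
    Metric.eventually_nhds_iff.1 (hcont.continuousAt.eventually_lt continuousAt_const hgc)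
  set q : ℝ := min (pc + ε / 2) 1 with hq
  have hqpc : pc < q := lt_min (by linarith) hpc1
  have hq1 : q ≤ 1 := min_le_right _ _
  have hq0 : 0 ≤ q := hpc0.trans hqpc.le
  have hdist : dist q pc < ε := by
    rw [Real.dist_eq, abs_of_pos (sub_pos.2 hqpc)]
    have : q ≤ pc + ε / 2 := min_le_left _ _
    linarith
  have hgq : g q < 1 := hball hdist
  have hφq : DCT16.phi ⟨q, hq0, hq1⟩ S < 1 := by rw [hφg]; exact hgq
  have hle : q ≤ DCT16.tildeCriticalProb d :=
    le_csSup (DCT16.bddAbove_tildeSet d) ⟨⟨hq0, hq1⟩, S, h0, hφq⟩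
  have := hle.trans (tildeCriticalProb_le_criticalProb d)
  linarith

/-- From `φ_p(Λ_n) ≥ 1`: the shell sum `Σ_{x ∈ ∂Λ_n} P_p(0 ↔ x in Λ_n) ≥ 1/(2d)` (each site has `2d`
neighbours, and only sites of `∂Λ_n` have neighbours outside `Λ_n`). -/
theorem shell_sum_ge (hd : 1 ≤ d) (p : unitInterval) (n : ℕ) (hφ : 1 ≤ DCT16.phi p (box d n)) :
    1 / (2 * d : ℝ) ≤ ∑ x ∈ innerBoundary (zdGraph d) (box d n),
      (bondPercolation (zdGraph d) p).real (openConnIn (↑(box d n) : Set (Site d)) 0 x) := by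
  set P : Site d → ℝ := fun x =>
    (bondPercolation (zdGraph d) p).real (openConnIn (↑(box d n) : Set (Site d)) 0 x) with hP
  have hP0 : ∀ x, 0 ≤ P x := fun x => measureReal_nonneg
  have hinner : ∀ x ∈ box d n, (∑ y ∈ (zdGraph d).neighborFinset x with y ∉ box d n, P x)
      ≤ (2 * d : ℝ) * (if x ∈ innerBoundary (zdGraph d) (box d n) then P x else 0) := by
    intro x hx
    rw [Finset.sum_const, nsmul_eq_mul]
    split_ifs with hxb
    · have hcard : ((({y ∈ (zdGraph d).neighborFinset x | y ∉ box d n} : Finset (Site d))).card : ℝ) ≤ 2 * d := by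
        have h1 := Finset.card_filter_le ((zdGraph d).neighborFinset x) (fun y => y ∉ box d n)
        rw [card_neighborFinset_zdGraph_holds x] at h1
        exact_mod_cast h1
      exact mul_le_mul_of_nonneg_right hcard (hP0 x)
    · have hempty : {y ∈ (zdGraph d).neighborFinset x | y ∉ box d n} = ∅ := by
        rw [Finset.filter_eq_empty_iff]
        intro y hy hyn
        exact hxb (mem_innerBoundary_iff.2 ⟨hx, y, hyn, (SimpleGraph.mem_neighborFinset _ _ _).1 hy⟩)
      rw [hempty]; simp
  have h1 : DCT16.phi p (box d n) ≤ (2 * d : ℝ) * ∑ x ∈ innerBoundary (zdGraph d) (box d n), P x := by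
    rw [DCT16.phi_def]
    have hp1 : (p : ℝ) ≤ 1 := p.2.2
    have hsub : innerBoundary (zdGraph d) (box d n) ⊆ box d n := Finset.filter_subset _ _
    calc (p : ℝ) * ∑ x ∈ box d n, ∑ y ∈ (zdGraph d).neighborFinset x with y ∉ box d n, P x
        ≤ 1 * ∑ x ∈ box d n, (2 * d : ℝ) *
            (if x ∈ innerBoundary (zdGraph d) (box d n) then P x else 0) :=
          mul_le_mul hp1 (Finset.sum_le_sum hinner)
            (Finset.sum_nonneg fun x _ => Finset.sum_nonneg fun _ _ => hP0 x) zero_le_one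
      _ = (2 * d : ℝ) * ∑ x ∈ innerBoundary (zdGraph d) (box d n), P x := by
          rw [one_mul, ← Finset.mul_sum, ← Finset.sum_filter, Finset.filter_mem_eq_inter,
            Finset.inter_eq_right.2 hsub]
  have h2 : (1 : ℝ) ≤ (2 * d : ℝ) * ∑ x ∈ innerBoundary (zdGraph d) (box d n), P x := hφ.trans h1
  have hd' : (0 : ℝ) < 2 * d := by
    have : (1 : ℝ) ≤ d := by exact_mod_cast hd
    linarith
  rw [div_le_iff₀ hd']
  linarith [mul_comm (2 * d : ℝ) (∑ x ∈ innerBoundary (zdGraph d) (box d n), P x)]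

/-- The shells `∂Λ_1, …, ∂Λ_R` are pairwise disjoint. -/
theorem pairwiseDisjoint_shells (d R : ℕ) :
    (↑(Finset.Icc 1 R) : Set ℕ).PairwiseDisjoint fun n => innerBoundary (zdGraph d) (box d n) := by
  intro m _ n _ hmn
  simp only [Function.onFun]
  rw [Finset.disjoint_left]
  intro x hxm hxn
  rcases lt_or_gt_of_ne hmn with h | h
  · exact notMem_box_of_mem_innerBoundary_box h hxn (mem_innerBoundary_iff.1 hxm).1
  · exact notMem_box_of_mem_innerBoundary_box h hxm (mem_innerBoundary_iff.1 hxn).1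

/-- The union of the shells `∂Λ_1 ∪ … ∪ ∂Λ_R` lies in `Λ_R`. -/
theorem shells_subset_box (d R : ℕ) :
    ((Finset.Icc 1 R).biUnion fun n => innerBoundary (zdGraph d) (box d n)) ⊆ box d R := by
  intro x hx
  rw [Finset.mem_biUnion] at hx
  obtain ⟨n, hn, hxn⟩ := hx
  exact box_mono d (Finset.mem_Icc.1 hn).2 ((mem_innerBoundary_iff.1 hxn).1)

/-- **Rigorous floor** (Duminil-Copin–Tassion / Hammersley–Simon–Lieb): `χᶠ_R(p_c) ≥ R/(2d)` on
`ℤ^d`, `d ≥ 2`: sum `φ_{p_c}(Λ_n) ≥ 1` over the disjoint shells `∂Λ_n ⊆ Λ_R`, `1 ≤ n ≤ R`, using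
`{0 ↔ x in Λ_n} ⊆ {0 ↔ x in Λ_R}`. -/
theorem freeSusc_crit_ge (hd : 2 ≤ d) (R : ℕ) :
    (R : ℝ) / (2 * d) ≤ freeSusc d (criticalProbI d) R := by
  set p := criticalProbI d with hp
  set f : Site d → ℝ := fun y =>
    (bondPercolation (zdGraph d) p).real (openConnIn (↑(box d R) : Set (Site d)) 0 y) with hf
  have hf0 : ∀ y, 0 ≤ f y := fun _ => measureReal_nonneg
  calc (R : ℝ) / (2 * d) = ∑ _n ∈ Finset.Icc 1 R, 1 / (2 * d : ℝ) := by
        rw [Finset.sum_const, Nat.card_Icc, Nat.add_sub_cancel, nsmul_eq_mul]; ring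
    _ ≤ ∑ n ∈ Finset.Icc 1 R, ∑ x ∈ innerBoundary (zdGraph d) (box d n),
          (bondPercolation (zdGraph d) p).real (openConnIn (↑(box d n) : Set (Site d)) 0 x) :=
        Finset.sum_le_sum fun n _ =>
          shell_sum_ge (by omega) p n (one_le_phi_crit hd _ (zero_mem_box d n))
    _ ≤ ∑ n ∈ Finset.Icc 1 R, ∑ x ∈ innerBoundary (zdGraph d) (box d n), f x := by
        refine Finset.sum_le_sum fun n hn => Finset.sum_le_sum fun x _ => ?_
        exact measureReal_mono (openConnIn_mono_set
          (Finset.coe_subset.2 (box_mono d (Finset.mem_Icc.1 hn).2)) 0 x)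
    _ = ∑ x ∈ (Finset.Icc 1 R).biUnion fun n => innerBoundary (zdGraph d) (box d n), f x :=
        (Finset.sum_biUnion (pairwiseDisjoint_shells d R)).symm
    _ ≤ ∑ x ∈ box d R, f x :=
        Finset.sum_le_sum_of_subset_of_nonneg (shells_subset_box d R) fun _ _ _ => hf0 _
    _ = freeSusc d p R := rfl

/-- **The exponent in S cannot be lowered below `1`**: `¬ PowerBound d p_c e` for `e < 1`, `d ≥ 2`.
(Rigorous window for `e` in `d = 3`: `[1, 3]`; crux: `5/2`; numerics: `2.05`.) -/
theorem not_powerBound_crit_of_lt_one (hd : 2 ≤ d) {e : ℝ} (he : e < 1) :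
    ¬ PowerBound d (criticalProbI d) e := by
  have hd' : (0 : ℝ) < 2 * d := by
    have : (2 : ℝ) ≤ d := by exact_mod_cast hd
    linarith
  refine not_bound_of_lower (f := freeSusc d (criticalProbI d)) (a := 1 / (2 * d)) (s := 1)
    (by positivity) (N := 0) (fun R _ => ?_) he
  rw [Real.rpow_one, one_div, inv_mul_eq_div]
  exact freeSusc_crit_ge hd R

/-- In `d = 3`: `χᶠ_R(p_c) ≥ R/6`, and no `S(a)` with `a > 2` (exponent `< 1`) can hold. -/
theorem crux_exponent_floor {e : ℝ} (he : e < 1) : ¬ PowerBound 3 (criticalProbI 3) e :=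
  not_powerBound_crit_of_lt_one (d := 3) (by norm_num) he

/-! ### (a) Load-bearing: criticality from below — for `p < p_c` even the exponent `0` holds -/

/-- A non-zero site of `Λ_R` lies on the shell `∂Λ_n`, `n = ‖y‖_∞ ∈ [1, R]`. -/
theorem mem_shells_of_ne_zero (hd : 1 ≤ d) {R : ℕ} {y : Site d} (hy : y ∈ box d R) (hy0 : y ≠ 0) :
    y ∈ (Finset.Icc 1 R).biUnion fun n => innerBoundary (zdGraph d) (box d n) := by
  classical
  have hne : (Finset.univ : Finset (Fin d)).Nonempty :=
    Finset.univ_nonempty_iff.2 ⟨⟨0, hd⟩⟩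
  obtain ⟨i, -, hi⟩ := Finset.exists_mem_eq_sup Finset.univ hne fun j => (y j).natAbs
  set n : ℕ := Finset.univ.sup fun j => (y j).natAbs with hn
  have hle : ∀ j, (y j).natAbs ≤ n := fun j =>
    Finset.le_sup (f := fun j => (y j).natAbs) (Finset.mem_univ j)
  have hyn : y ∈ box d n := by
    rw [mem_box]; intro j; have := hle j; omega
  have hnR : n ≤ R := by
    rw [mem_box] at hy
    rw [hi]; have := hy i; omega
  have hn1 : 1 ≤ n := by
    by_contra h
    push Not at h
    apply hy0
    funext j
    have := hle j
    simp only [Pi.zero_apply]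
    omega
  rw [Finset.mem_biUnion]
  exact ⟨n, Finset.mem_Icc.2 ⟨hn1, hnR⟩, mem_innerBoundary_box_of_natAbs_eq hyn hi.symm⟩

/-- `0` is on no shell `∂Λ_n`, `n ≥ 1`. -/
theorem zero_notMem_shells (d R : ℕ) :
    (0 : Site d) ∉ (Finset.Icc 1 R).biUnion fun n => innerBoundary (zdGraph d) (box d n) := by
  rw [Finset.mem_biUnion]
  rintro ⟨n, hn, h0⟩
  exact notMem_box_of_mem_innerBoundary_box (Finset.mem_Icc.1 hn).1 h0 (zero_mem_box d 0)

/-- For `x ∈ ∂Λ_n`, `n ≤ R`: `P_p(0 ↔ x in Λ_R) ≤ P_p(0 ↔ ∂Λ_n)` (first exit from `Λ_n`). -/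
theorem real_openConnIn_le_siteToBoundary (p : unitInterval) {n R : ℕ} {x : Site d}
    (hx : x ∈ innerBoundary (zdGraph d) (box d n)) :
    (bondPercolation (zdGraph d) p).real (openConnIn (↑(box d R) : Set (Site d)) 0 x) ≤
      (bondPercolation (zdGraph d) p).real (siteToBoundary d n) := by
  refine real_mono_of_forall_subset_edgeSet (zdGraph d) p fun ω hω h => ?_
  rw [← armEvent_zero]
  exact armEvent_of_pathIn hω (pathIn_of_mem_openConnIn h) (Or.inr (by rw [sub_zero]; exact hx))

/-- **Subcritical triviality**: for `p < p_c(ℤ^d)`, `d ≥ 2`, the free susceptibility is bounded in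
`R` (`PowerBound d p 0`), by the exponential decay of `P_p(0 ↔ ∂Λ_n)` (Menshikov / Aizenman–Barsky /
Duminil-Copin–Tassion, tree: `perc_sharpness_holds`).  Together with `not_powerBound_one` and the
conjectured failure just above `p_c` this pins the crux exactly AT `p_c`. -/
theorem powerBound_zero_of_lt_criticalProb (hd : 2 ≤ d) (p : unitInterval)
    (hp : (p : ℝ) < criticalProb (zdGraph d) 0) : PowerBound d p 0 := by
  obtain ⟨c, hc, hdec⟩ := perc_sharpness_holds hd p hp
  -- summable majorant `g n = (3^d n^d + 1) e^{-cn} ≥ (2n+1)^d e^{-cn}`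
  set g : ℕ → ℝ := fun n => ((3 : ℝ) ^ d * (n : ℝ) ^ d + 1) * Real.exp (-c * n) with hg
  have hg0 : ∀ n, 0 ≤ g n := fun n => by positivity
  have hgs : Summable g := by
    have h1 := (Real.summable_pow_mul_exp_neg_nat_mul d hc).mul_left ((3 : ℝ) ^ d)
    have h2 := Real.summable_pow_mul_exp_neg_nat_mul 0 hc
    simp only [pow_zero, one_mul] at h2
    have heq : g = fun n : ℕ =>
        (3 : ℝ) ^ d * ((n : ℝ) ^ d * Real.exp (-c * n)) + Real.exp (-c * n) := by
      funext n; simp only [hg]; ring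
    rw [heq]; exact h1.add h2
  refine ⟨1 + ∑' n, g n, fun R _ => ?_⟩
  rw [Real.rpow_zero, mul_one]
  set f : Site d → ℝ := fun y =>
    (bondPercolation (zdGraph d) p).real (openConnIn (↑(box d R) : Set (Site d)) 0 y) with hf
  have hf0 : ∀ y, 0 ≤ f y := fun _ => measureReal_nonneg
  set U := (Finset.Icc 1 R).biUnion fun n => innerBoundary (zdGraph d) (box d n) with hU
  have hsub : box d R ⊆ insert (0 : Site d) U := by
    intro y hy
    by_cases hy0 : y = 0
    · rw [hy0]; exact Finset.mem_insert_self _ _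
    · exact Finset.mem_insert_of_mem (mem_shells_of_ne_zero (by omega) hy hy0)
  calc freeSusc d p R = ∑ y ∈ box d R, f y := rfl
    _ ≤ ∑ y ∈ insert (0 : Site d) U, f y :=
        Finset.sum_le_sum_of_subset_of_nonneg hsub fun _ _ _ => hf0 _
    _ = f 0 + ∑ y ∈ U, f y := Finset.sum_insert (zero_notMem_shells d R)
    _ = 1 + ∑ n ∈ Finset.Icc 1 R, ∑ x ∈ innerBoundary (zdGraph d) (box d n), f x := by
        rw [hf]; beta_reduce; rw [real_openConnIn_self, Finset.sum_biUnion (pairwiseDisjoint_shells d R)]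
    _ ≤ 1 + ∑ n ∈ Finset.Icc 1 R, ∑ _x ∈ innerBoundary (zdGraph d) (box d n), Real.exp (-c * n) := by
        gcongr with n hn x hx
        exact (real_openConnIn_le_siteToBoundary p hx).trans (hdec n)
    _ ≤ 1 + ∑ n ∈ Finset.Icc 1 R, g n := by
        gcongr with n hn
        rw [Finset.sum_const, nsmul_eq_mul]
        refine mul_le_mul_of_nonneg_right ?_ (Real.exp_nonneg _)
        have hn1 : (1 : ℝ) ≤ n := by exact_mod_cast (Finset.mem_Icc.1 hn).1
        calc ((innerBoundary (zdGraph d) (box d n)).card : ℝ) ≤ (box d n).card := by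
              exact_mod_cast Finset.card_le_card (Finset.filter_subset _ _)
          _ = ((2 * n + 1 : ℕ) : ℝ) ^ d := by rw [card_box]; push_cast; ring
          _ ≤ ((3 : ℝ) * n) ^ d := by
              apply pow_le_pow_left₀ (by positivity); push_cast; linarith
          _ ≤ (3 : ℝ) ^ d * (n : ℝ) ^ d + 1 := by rw [mul_pow]; linarith
    _ ≤ 1 + ∑' n, g n := by
        gcongr
        exact hgs.sum_le_tsum _ fun n _ => hg0 n

/-! ### (c) The monolithic-jump obstruction: in-box LRO at `p_c` versus any power saving -/

/-- **Linear-scale in-box long-range order at `p_c` on `ℤ³`** (the MONOLITHIC jump branch of a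
discontinuous transition): in-box connection probabilities from the centre to every site of the
half-box `Λ_{⌊R/2⌋}` stay bounded below for large `R`.  STATUS: not known to be false.  Its negation
would follow from the free-box 'folklore theorem' `|Λ_r|⁻¹ Σ_{x∈Λ_r} P_{p_c}(0 ↔ x inside Λ_r) → 0`
asserted WITHOUT proof or reference in Hutchcroft, JMP 2022 = arXiv:2202.07634 p.5 ("well-known (and
not too difficult) … in every d ≥ 2"); no proof has been located or rebuilt in-house (cards
`free-box-folklore-knife-edge`, `shattered-or-untouching-free-average-v2`: the visible lowest-point
BK + BGN route needs `x_s + x_b > 3/2`, numerically `1.45`).  `BoxLRO` implies `θ(p_c) > 0`-type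
behaviour and is a sub-case of the negation of the summit. -/
def BoxLRO : Prop :=
  ∃ c : ℝ, 0 < c ∧ ∃ N : ℕ, ∀ R : ℕ, N ≤ R → ∀ y ∈ box 3 (R / 2),
    c ≤ (bondPercolation (zdGraph 3) (criticalProbI 3)).real
      (openConnIn (↑(box 3 R) : Set (Site 3)) 0 y)

/-- Under `BoxLRO` the free susceptibility is of volume order: `χᶠ_R(p_c) ≥ c R³` for `R ≥ N`. -/
theorem freeSusc_ge_of_boxLRO {c : ℝ} {N R : ℕ} (hNR : N ≤ R)
    (h : ∀ R : ℕ, N ≤ R → ∀ y ∈ box 3 (R / 2), c ≤ (bondPercolation (zdGraph 3) (criticalProbI 3)).real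
      (openConnIn (↑(box 3 R) : Set (Site 3)) 0 y)) :
    c * (R : ℝ) ^ (3 : ℝ) ≤ freeSusc 3 (criticalProbI 3) R := by
  have hsub : box 3 (R / 2) ⊆ box 3 R := box_mono 3 (Nat.div_le_self R 2)
  have hcard : (R : ℝ) ^ (3 : ℝ) ≤ (box 3 (R / 2)).card := by
    rw [show (3 : ℝ) = (3 : ℕ) by norm_num, Real.rpow_natCast, card_box]
    have : R ≤ 2 * (R / 2) + 1 := by omega
    exact_mod_cast Nat.pow_le_pow_left this 3
  calc c * (R : ℝ) ^ (3 : ℝ) ≤ ∑ y ∈ box 3 (R / 2), (bondPercolation (zdGraph 3) (criticalProbI 3)).real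
        (openConnIn (↑(box 3 R) : Set (Site 3)) 0 y) := by
          rcases le_or_gt 0 c with hc | hc
          · calc c * (R : ℝ) ^ (3 : ℝ) ≤ c * (box 3 (R / 2)).card := mul_le_mul_of_nonneg_left hcard hc
              _ = ∑ _y ∈ box 3 (R / 2), c := by rw [Finset.sum_const, nsmul_eq_mul, mul_comm]
              _ ≤ _ := Finset.sum_le_sum fun y hy => h R hNR y hy
          · exact (mul_nonpos_of_nonpos_of_nonneg hc.le (by positivity)).trans
              (Finset.sum_nonneg fun _ _ => measureReal_nonneg)
    _ ≤ freeSusc 3 (criticalProbI 3) R :=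
        Finset.sum_le_sum_of_subset_of_nonneg hsub fun _ _ _ => measureReal_nonneg

/-- **`BoxLRO` kills every power saving**: `BoxLRO → ¬ PowerBound 3 p_c e` for all `e < 3`. -/
theorem not_powerBound_of_boxLRO (h : BoxLRO) {e : ℝ} (he : e < 3) :
    ¬ PowerBound 3 (criticalProbI 3) e := by
  obtain ⟨c, hc, N, hN⟩ := h
  exact not_bound_of_lower (f := freeSusc 3 (criticalProbI 3)) hc (N := N)
    (fun R hR => freeSusc_ge_of_boxLRO hR hN) he

/-- **`BoxLRO` is a sub-case of the jump**: it forces `θ(p_c) ≥ c > 0` (the site `n e₀ ∈ ∂Λ_n` is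
joined to `0` inside `Λ_R`, `R = 2 max(N, n)`, with probability `≥ c`, so `P_{p_c}(0 ↔ ∂Λ_n) ≥ c` for
every `n`, and `n → ∞`). Hence `BoxLRO → ¬ PercolationContinuityZ3`. -/
theorem theta_pos_of_boxLRO (h : BoxLRO) :
    0 < theta (zdGraph 3) (0 : Site 3) (criticalProbI 3) := by
  obtain ⟨c, hc, N, hN⟩ := h
  refine lt_of_lt_of_le hc (le_theta_of_forall_le_real_siteToBoundary (criticalProbI 3) fun n => ?_)
  set R : ℕ := 2 * max N n with hR
  have hRN : N ≤ R := by rw [hR]; omega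
  have hR2 : R / 2 = max N n := by rw [hR]; omega
  set y : Site 3 := Pi.single 0 (n : ℤ) with hy
  have hyn : y ∈ box 3 n := by
    rw [mem_box]; intro i
    rcases eq_or_ne i 0 with rfl | hi
    · simp [hy]
    · simp [hy, Pi.single_eq_of_ne hi]
  have hybd : y ∈ innerBoundary (zdGraph 3) (box 3 n) :=
    mem_innerBoundary_box_of_natAbs_eq hyn (i := 0) (by simp [hy])
  have hyR : y ∈ box 3 (R / 2) := by rw [hR2]; exact box_mono 3 (le_max_right N n) hyn
  exact (hN R hRN y hyR).trans (real_openConnIn_le_siteToBoundary (criticalProbI 3) hybd)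

/-- `BoxLRO` contradicts the summit statement `θ(p_c) = 0`. -/
theorem not_percolationContinuityZ3_of_boxLRO (h : BoxLRO) : ¬ _root_.PercolationContinuityZ3 := by
  rw [_root_.PercolationContinuityZ3, percolationContinuityZ3_iff]
  exact (theta_pos_of_boxLRO h).ne'

/-- Contrapositive: **S (indeed any `S(a)`, `a > 0`) refutes the monolithic jump branch**.  Since
`BoxLRO` is an open sub-case of `θ(p_c) > 0`, S admits no proof from soft (dimension-free,
`p`-monotone) considerations alone — WHY THE CRUX RESISTS both proof and disproof. -/
theorem not_boxLRO_of_crux (hS : FreeSusceptibilityPowerSaving) : ¬ BoxLRO := fun h =>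
  not_powerBound_of_boxLRO h (by norm_num) (crux_iff.1 hS)

end

end Summit.CriticalPhenomena.PercolationContinuityZ3.Cruxes.FreeSusceptibilityPowerSaving.Disproof
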